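import Mathlib
import Summits.Ventures.PercRepro2.PointSplitSourceLeaf
import Summits.Ventures.PercRepro2.ThreeMarkPointSplit
import Summits.Ventures.PercRepro2.ThreeMarkOne

/-!
# (PS) and (PS1) are THEOREMS at every leaf of the source, with arbitrary avoidance — and so are
(3M) and (3M1) when the mark `v` is a leaf hanging from `a₂`
(blind cell PercRepro2, night-3 g23, 2026-08-28; `proofs/NIGHT3-CERT.md` §32.16)

`PointSplitSourceLeaf.lean` treated `X = Y = ∅`.  Here the avoided sets `X, Y` are arbitrary with
`v ∉ X ∪ Y` (the other case is BHK itself, `PointSplitAvoid.lean`).  The point is that a leaf `v` of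
`s` with edge `e` cannot help `s` reach anything else: `C_s(ω[e:=1]) ⊆ C_s(ω) ∪ {v}`
(`cluster_update_true_subset_leaf`), so the avoidance indicators of `X`, `Y`, `X ∪ Y` are the same
under `e` open and `e` closed (`indicator_avoidAll_update_leaf`).  Pinning the law at `e`
(`wExpect_indicator_leaf_pin`, `wExpect_one_pin`) gives, with `E¹, E⁰` the laws `p[e:=1], p[e:=0]`,
`q = p_e`, `S¹, S⁰` their BHK slacks (`≥ 0` by `bhkForm_one_nonneg`, these being product laws),
`a¹ = E¹[F; X] ≥ a⁰ = E⁰[F; X]` and `c¹ = E¹[G; Y] ≥ c⁰` (`wExpect_update_zero_le_update_one_leaf`),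

  `M(1_{vH}, 1) = q·[2q·S¹ + (1 − q)(S¹ + S⁰ + (a¹ − a⁰)(c¹ − c⁰))]`,
  `M(1_{vH}, 1_{v̄H}) = q(1 − q)·(S¹ + S⁰ + (a¹ − a⁰)(c¹ − c⁰))`,

hence `mixedForm_one_nonneg_sourceLeaf_avoid` ((PS1)) and `mixedForm_split_nonneg_sourceLeaf_avoid`
((PS)).  Through `threeMark_slack_eq_mixedForm` / `threeMarkOne_slack_eq_mixedForm` this proves the
unmerged 5-mark inequality (3M) = `RootEdge.ThreeMark` and (3M1) = `ThreeMarkOne` whenever the mark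
`v` is a leaf hanging from `a₂` (`threeMark_of_sourceLeaf`, `threeMarkOne_of_sourceLeaf`).  (The crux
needs (3M) for `v` at a ROOT edge `{a₁, v}`, which a leaf of `a₂` is not; this is a different, fully
proved region of the statement.)  Own work; standard axioms.
-/

namespace Summit.Ventures.PercRepro2

open UnionCluster

namespace CovForm

namespace PointSplit

variable {V : Type*} {E : Type*} [Fintype E] [DecidableEq E]
  {R : Type*} [Field R] [LinearOrder R] [IsStrictOrderedRing R]

omit [Fintype E] [LinearOrder R] [IsStrictOrderedRing R] in
/-- Opening the leaf edge `e = {s, v}` adds at most `v` to the cluster of `s`. -/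
lemma cluster_update_true_subset_leaf {ends : E → Sym2 V} {e : E} {s v : V}
    (hends : ends e = s(s, v)) (hleaf : ∀ f, v ∈ ends f → f = e) (ω : Config E) :
    cluster ends (Function.update ω e true) s ⊆ cluster ends ω s ∪ {v} := by
  intro x hx
  rw [mem_cluster] at hx
  refine mem_of_conn_of_closed (S := cluster ends ω s ∪ {v}) ?_
    (Or.inl ((mem_cluster).2 (conn_refl ends ω s))) hx
  intro y hy z hyz
  rw [openGraph_adj] at hyz
  obtain ⟨_, f, hf, hends'⟩ := hyz
  by_cases hfe : f = e
  · subst hfe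
    rw [hends] at hends'
    -- `{s, v} = {y, z}`: `z = s` or `z = v`
    rcases Sym2.eq_iff.1 hends' with ⟨_, hz⟩ | ⟨hs, _⟩
    · exact Or.inr (by simp [← hz])
    · exact Or.inl (by rw [← hs]; exact (mem_cluster).2 (conn_refl ends ω s))
  · rw [Function.update_of_ne hfe] at hf
    rcases hy with hy | hy
    · exact Or.inl ((mem_cluster).2 (conn_trans ((mem_cluster).1 hy)
        (conn_of_openAdj ⟨f, hf, hends'⟩)))
    · exfalso
      have hyv : y = v := by simpa using hy
      subst hyv
      exact hfe (hleaf f (by rw [hends']; exact Sym2.mem_mk_left y z))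

omit [Fintype E] [LinearOrder R] [IsStrictOrderedRing R] in
/-- For `v ∉ X`, `ω[e:=1]` avoids `X` iff `ω[e:=0]` does. -/
lemma mem_avoidAll_update_leaf {ends : E → Sym2 V} {e : E} {s v : V}
    (hends : ends e = s(s, v)) (hleaf : ∀ f, v ∈ ends f → f = e) {X : Finset V} (hv : v ∉ X)
    (ω : Config E) :
    Function.update ω e true ∈ avoidAll ends s X ↔ Function.update ω e false ∈ avoidAll ends s X := by
  constructor
  · intro h x hx hc
    exact h x hx (conn_mono (update_false_le_update_true ω e) hc)
  · intro h x hx hc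
    have hsub := cluster_update_true_subset_leaf hends hleaf (Function.update ω e false)
    rw [Function.update_idem] at hsub
    rcases hsub ((mem_cluster).2 hc) with hx' | hx'
    · exact h x hx ((mem_cluster).1 hx')
    · exact hv (by simpa using hx' ▸ hx)

omit [Fintype E] [LinearOrder R] [IsStrictOrderedRing R] in
/-- The avoidance indicator of `X ∌ v` does not see the leaf edge. -/
lemma indicator_avoidAll_update_leaf {ends : E → Sym2 V} {e : E} {s v : V}
    (hends : ends e = s(s, v)) (hleaf : ∀ f, v ∈ ends f → f = e) {X : Finset V} (hv : v ∉ X)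
    (ω : Config E) :
    (avoidAll ends s X).indicator (1 : Config E → R) (Function.update ω e true) =
      (avoidAll ends s X).indicator 1 (Function.update ω e false) := by
  by_cases h : Function.update ω e true ∈ avoidAll ends s X
  · rw [Set.indicator_of_mem h,
      Set.indicator_of_mem ((mem_avoidAll_update_leaf hends hleaf hv ω).1 h)]
    rfl
  · rw [Set.indicator_of_notMem h,
      Set.indicator_of_notMem (fun h' => h ((mem_avoidAll_update_leaf hends hleaf hv ω).2 h'))]

omit [LinearOrder R] [IsStrictOrderedRing R] in
/-- Pinning the weight `1_{v ∈ C_s}` of a source leaf: `E_p[F·1_{vH}; X] = p_e · E¹[F; X]`. -/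
lemma wExpect_indicator_leaf_pin (p : E → R) {ends : E → Sym2 V} {e : E} {s v : V} (hsv : s ≠ v)
    (hends : ends e = s(s, v)) (hleaf : ∀ f, v ∈ ends f → f = e) (X : Finset V) (F : Set V → R) :
    wExpect p ends s X F ((connEvent ends s v).indicator 1) =
      p e * wExpect (Function.update p e 1) ends s X F (fun _ => 1) := by
  unfold wExpect
  rw [← expect_mul_open_eq p e (fun ω => F (cluster ends ω s) * 1 * (avoidAll ends s X).indicator 1 ω)]
  refine congrArg _ (funext fun ω => ?_)
  rw [indicator_conn_leaf hsv hends hleaf]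
  ring

omit [LinearOrder R] [IsStrictOrderedRing R] in
/-- Pinning the weight `1_{v ∉ C_s}` of a source leaf: `E_p[F·1_{v̄H}; X] = (1 − p_e) · E⁰[F; X]`. -/
lemma wExpect_indicator_compl_leaf_pin (p : E → R) {ends : E → Sym2 V} {e : E} {s v : V}
    (hsv : s ≠ v) (hends : ends e = s(s, v)) (hleaf : ∀ f, v ∈ ends f → f = e) (X : Finset V)
    (F : Set V → R) :
    wExpect p ends s X F (((connEvent ends s v)ᶜ).indicator 1) =
      (1 - p e) * wExpect (Function.update p e 0) ends s X F (fun _ => 1) := by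
  unfold wExpect
  rw [← expect_mul_closed_eq p e
    (fun ω => F (cluster ends ω s) * 1 * (avoidAll ends s X).indicator 1 ω)]
  refine congrArg _ (funext fun ω => ?_)
  rw [indicator_conn_compl_leaf hsv hends hleaf]
  ring

omit [LinearOrder R] [IsStrictOrderedRing R] in
/-- Pinning the weight `1`: `E_p[F; X] = p_e · E¹[F; X] + (1 − p_e) · E⁰[F; X]`. -/
lemma wExpect_one_pin (p : E → R) (ends : E → Sym2 V) (s : V) (e : E) (X : Finset V)
    (F : Set V → R) :
    wExpect p ends s X F (fun _ => 1) =
      p e * wExpect (Function.update p e 1) ends s X F (fun _ => 1) +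
        (1 - p e) * wExpect (Function.update p e 0) ends s X F (fun _ => 1) := by
  unfold wExpect
  exact expect_eq_pin p _ e

/-- Monotonicity in the pin at a source leaf: `E⁰[F; X] ≤ E¹[F; X]` for monotone `F` and `v ∉ X`. -/
lemma wExpect_update_zero_le_update_one_leaf {p : E → R} (hp : IsProbVec p) {ends : E → Sym2 V}
    {e : E} {s v : V} (hends : ends e = s(s, v)) (hleaf : ∀ f, v ∈ ends f → f = e) {X : Finset V}
    (hv : v ∉ X) {F : Set V → R} (hF : Monotone F) :
    wExpect (Function.update p e 0) ends s X F (fun _ => 1) ≤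
      wExpect (Function.update p e 1) ends s X F (fun _ => 1) := by
  unfold wExpect
  rw [expect_update_zero, expect_update_one]
  refine expect_mono hp fun ω => ?_
  simp only [mul_one]
  rw [indicator_avoidAll_update_leaf hends hleaf hv ω]
  exact mul_le_mul_of_nonneg_right (hF (cluster_mono (update_false_le_update_true ω e) s))
    (Set.indicator_apply_nonneg fun _ => zero_le_one)

omit [LinearOrder R] [IsStrictOrderedRing R] in
/-- The avoidance probability of `X ∌ v` is the same under both pins of the leaf edge. -/
lemma wExpect_one_update_eq_leaf (p : E → R) {ends : E → Sym2 V} {e : E} {s v : V}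
    (hends : ends e = s(s, v)) (hleaf : ∀ f, v ∈ ends f → f = e) {X : Finset V} (hv : v ∉ X) :
    wExpect (Function.update p e 0) ends s X (fun _ => 1) (fun _ => 1) =
      wExpect (Function.update p e 1) ends s X (fun _ => 1) (fun _ => 1) := by
  unfold wExpect
  rw [expect_update_zero, expect_update_one]
  refine congrArg _ (funext fun ω => ?_)
  simp only [mul_one, one_mul]
  exact (indicator_avoidAll_update_leaf hends hleaf hv ω).symm

/-- **(PS1) at a source leaf with arbitrary avoidance** (`v ∉ X ∪ Y`): `M(1_{vH}, 1) ≥ 0`. -/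
theorem mixedForm_one_nonneg_sourceLeaf_avoid [Fintype V] [DecidableEq V] (p : E → R)
    (hp : IsProbVec p) {ends : E → Sym2 V} {e : E} {s v : V} (hsv : s ≠ v)
    (hends : ends e = s(s, v)) (hleaf : ∀ f, v ∈ ends f → f = e) {X Y : Finset V} (hvX : v ∉ X)
    (hvY : v ∉ Y) {F G : Set V → R} (hF : Monotone F) (hG : Monotone G) (hF0 : ∀ S, 0 ≤ F S)
    (hG0 : ∀ S, 0 ≤ G S) :
    0 ≤ mixedFormW p ends s X Y F G ((connEvent ends s v).indicator 1) (fun _ => 1) := by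
  have hvU : v ∉ X ∪ Y := fun h => (Finset.mem_union.1 h).elim hvX hvY
  have hp₁ : IsProbVec (Function.update p e 1) := hp.update e zero_le_one le_rfl
  have hp₀ : IsProbVec (Function.update p e 0) := hp.update e le_rfl zero_le_one
  have hS₁ := bhkForm_one_nonneg (Function.update p e 1) hp₁ ends s X Y hF hG hF0 hG0
  have hS₀ := bhkForm_one_nonneg (Function.update p e 0) hp₀ ends s X Y hF hG hF0 hG0
  unfold bhkFormW at hS₁ hS₀
  have ha := wExpect_update_zero_le_update_one_leaf hp hends hleaf hvX hF
  have hc := wExpect_update_zero_le_update_one_leaf hp hends hleaf hvY hG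
  have hP := wExpect_one_update_eq_leaf p hends hleaf hvU
  have hq0 := hp.nonneg e
  have hq1 := hp.le_one e
  unfold mixedFormW
  rw [wExpect_indicator_leaf_pin p hsv hends hleaf, wExpect_indicator_leaf_pin p hsv hends hleaf,
    wExpect_indicator_leaf_pin p hsv hends hleaf, wExpect_indicator_leaf_pin p hsv hends hleaf,
    wExpect_one_pin p ends s e (X ∩ Y), wExpect_one_pin p ends s e (X ∪ Y),
    wExpect_one_pin p ends s e X, wExpect_one_pin p ends s e Y]
  rw [hP] at hS₀ ⊢
  set q := p e
  set u₁ := wExpect (Function.update p e 1) ends s (X ∩ Y) (fun W => F W * G W) fun _ => 1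
  set u₀ := wExpect (Function.update p e 0) ends s (X ∩ Y) (fun W => F W * G W) fun _ => 1
  set P := wExpect (Function.update p e 1) ends s (X ∪ Y) (fun _ => 1) fun _ => 1
  set a₁ := wExpect (Function.update p e 1) ends s X F fun _ => 1
  set a₀ := wExpect (Function.update p e 0) ends s X F fun _ => 1
  set c₁ := wExpect (Function.update p e 1) ends s Y G fun _ => 1
  set c₀ := wExpect (Function.update p e 0) ends s Y G fun _ => 1
  have key : 0 ≤ u₁ * P + u₀ * P - a₁ * c₀ - a₀ * c₁ := by nlinarith [hS₁, hS₀, ha, hc]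
  have hq : 0 ≤ q * (1 - q) := mul_nonneg hq0 (by linarith)
  nlinarith [key, hS₁, hq, hq0, mul_nonneg hq0 hq0]

/-- **(PS) at a source leaf with arbitrary avoidance** (`v ∉ X ∪ Y`): `M(1_{vH}, 1_{v̄H}) ≥ 0`. -/
theorem mixedForm_split_nonneg_sourceLeaf_avoid [Fintype V] [DecidableEq V] (p : E → R)
    (hp : IsProbVec p) {ends : E → Sym2 V} {e : E} {s v : V} (hsv : s ≠ v)
    (hends : ends e = s(s, v)) (hleaf : ∀ f, v ∈ ends f → f = e) {X Y : Finset V} (hvX : v ∉ X)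
    (hvY : v ∉ Y) {F G : Set V → R} (hF : Monotone F) (hG : Monotone G) (hF0 : ∀ S, 0 ≤ F S)
    (hG0 : ∀ S, 0 ≤ G S) :
    0 ≤ mixedFormW p ends s X Y F G ((connEvent ends s v).indicator 1)
      (((connEvent ends s v)ᶜ).indicator 1) := by
  have hvU : v ∉ X ∪ Y := fun h => (Finset.mem_union.1 h).elim hvX hvY
  have hp₁ : IsProbVec (Function.update p e 1) := hp.update e zero_le_one le_rfl
  have hp₀ : IsProbVec (Function.update p e 0) := hp.update e le_rfl zero_le_one
  have hS₁ := bhkForm_one_nonneg (Function.update p e 1) hp₁ ends s X Y hF hG hF0 hG0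
  have hS₀ := bhkForm_one_nonneg (Function.update p e 0) hp₀ ends s X Y hF hG hF0 hG0
  unfold bhkFormW at hS₁ hS₀
  have ha := wExpect_update_zero_le_update_one_leaf hp hends hleaf hvX hF
  have hc := wExpect_update_zero_le_update_one_leaf hp hends hleaf hvY hG
  have hP := wExpect_one_update_eq_leaf p hends hleaf hvU
  have hq0 := hp.nonneg e
  have hq1 := hp.le_one e
  unfold mixedFormW
  rw [wExpect_indicator_leaf_pin p hsv hends hleaf, wExpect_indicator_leaf_pin p hsv hends hleaf,
    wExpect_indicator_leaf_pin p hsv hends hleaf, wExpect_indicator_leaf_pin p hsv hends hleaf,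
    wExpect_indicator_compl_leaf_pin p hsv hends hleaf,
    wExpect_indicator_compl_leaf_pin p hsv hends hleaf,
    wExpect_indicator_compl_leaf_pin p hsv hends hleaf,
    wExpect_indicator_compl_leaf_pin p hsv hends hleaf]
  rw [hP] at hS₀ ⊢
  set q := p e
  set u₁ := wExpect (Function.update p e 1) ends s (X ∩ Y) (fun W => F W * G W) fun _ => 1
  set u₀ := wExpect (Function.update p e 0) ends s (X ∩ Y) (fun W => F W * G W) fun _ => 1
  set P := wExpect (Function.update p e 1) ends s (X ∪ Y) (fun _ => 1) fun _ => 1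
  set a₁ := wExpect (Function.update p e 1) ends s X F fun _ => 1
  set a₀ := wExpect (Function.update p e 0) ends s X F fun _ => 1
  set c₁ := wExpect (Function.update p e 1) ends s Y G fun _ => 1
  set c₀ := wExpect (Function.update p e 0) ends s Y G fun _ => 1
  have key : 0 ≤ u₁ * P + u₀ * P - a₁ * c₀ - a₀ * c₁ := by nlinarith [hS₁, hS₀, ha, hc]
  have hq : 0 ≤ q * (1 - q) := mul_nonneg hq0 (by linarith)
  nlinarith [key, hq]

/-- **(3M) holds when the mark `v` is a leaf hanging from `a₂`** (`v ≠ a₁`). -/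
theorem threeMark_of_sourceLeaf [Fintype V] [DecidableEq V] {ends : E → Sym2 V} {e : E}
    {a₁ a₂ b o v : V} (hsv : a₂ ≠ v) (hends : ends e = s(a₂, v)) (hleaf : ∀ f, v ∈ ends f → f = e)
    (hv : v ≠ a₁) : RootEdge.ThreeMark (R := R) ends a₁ a₂ b o v := by
  intro p hp
  have hg := delClusterProb_anti p hp ends a₁ (isUpperSet_mem_setOf b)
  have hF : Monotone (fun W => 1 - delClusterProb p ends a₁ {U | b ∈ U} W) := by
    intro W W' hWW'
    simp only
    linarith [hg hWW']
  have hF0 : ∀ S, 0 ≤ (fun W => 1 - delClusterProb p ends a₁ {U | b ∈ U} W) S := by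
    intro S
    simp only
    linarith [delClusterProb_le_one p hp ends a₁ {U | b ∈ U} S]
  have hG : Monotone ({W : Set V | o ∈ W}.indicator (1 : Set V → R)) :=
    monotone_indicator_one_of_isUpperSet (isUpperSet_mem_setOf o)
  have hG0 : ∀ S, 0 ≤ {W : Set V | o ∈ W}.indicator (1 : Set V → R) S :=
    fun S => Set.indicator_apply_nonneg fun _ => zero_le_one
  have hva : v ∉ ({a₁} : Finset V) := by simpa using hv
  have key := mixedForm_split_nonneg_sourceLeaf_avoid p hp hsv hends hleaf hva hva hF hG hF0 hG0
  rw [threeMark_slack_eq_mixedForm] at key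
  linarith [key]

/-- **(3M1) holds when the mark `v` is a leaf hanging from `a₂`** (`v ≠ a₁`). -/
theorem threeMarkOne_of_sourceLeaf [Fintype V] [DecidableEq V] {ends : E → Sym2 V} {e : E}
    {a₁ a₂ b o v : V} (hsv : a₂ ≠ v) (hends : ends e = s(a₂, v)) (hleaf : ∀ f, v ∈ ends f → f = e)
    (hv : v ≠ a₁) : ThreeMarkOne (R := R) ends a₁ a₂ b o v := by
  intro p hp
  have hg := delClusterProb_anti p hp ends a₁ (isUpperSet_mem_setOf b)
  have hF : Monotone (fun W => 1 - delClusterProb p ends a₁ {U | b ∈ U} W) := by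
    intro W W' hWW'
    simp only
    linarith [hg hWW']
  have hF0 : ∀ S, 0 ≤ (fun W => 1 - delClusterProb p ends a₁ {U | b ∈ U} W) S := by
    intro S
    simp only
    linarith [delClusterProb_le_one p hp ends a₁ {U | b ∈ U} S]
  have hG : Monotone ({W : Set V | o ∈ W}.indicator (1 : Set V → R)) :=
    monotone_indicator_one_of_isUpperSet (isUpperSet_mem_setOf o)
  have hG0 : ∀ S, 0 ≤ {W : Set V | o ∈ W}.indicator (1 : Set V → R) S :=
    fun S => Set.indicator_apply_nonneg fun _ => zero_le_one
  have hva : v ∉ ({a₁} : Finset V) := by simpa using hv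
  have key := mixedForm_one_nonneg_sourceLeaf_avoid p hp hsv hends hleaf hva hva hF hG hF0 hG0
  rw [threeMarkOne_slack_eq_mixedForm] at key
  linarith [key]

end PointSplit

end CovForm

end Summit.Ventures.PercRepro2
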